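import Mathlib
import Summits.NavierStokesRegularity.NavierStokesRegularity.Theorems.FilamentSkeletonRssClause13BandVirial

/-!
# Clause 13-J/13-R, brick B5 (band virial, CONCLUSION): the MODEL MOURRE INEQUALITY
# `(σ₀/√q)·‖Y‖₂² ≤ ‖M_qY‖₂ · ‖(τ−c)Y‖₂` for band-localised `Y`

Route `FilamentSkeletonRss`, ∃-side clause 13 (`Clause13RNearStraightL` stmt-NavierStokesRegularity-23612 = A1R twin of 23321; typing-agnostic);
design of record `filament-plan/DESIGN-NOTE-28296-tenure-g22.md` §4: "⇒ for Y frequency-localised where 𝔖′(μk) ≥ ½𝔖′(x*): ‖DT·Y‖₂ ≥ [Γγ_j𝔖′(x*)/(4πμ)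
− …]·(cg/(2R))·‖Y‖₂" — the Mourre estimate: the virial identity bounds ‖Y‖² by the commutator, and Cauchy–Schwarz by ‖DT·Y‖·‖(τ−c)Y‖.  This file is
that last step for the MODEL self operator `M_q = (2/q)·I − K_q∗` (B2; `K_q(s) = (2q−s²)(s²+q)^{-5/2}`), on top of `band_virial_identity` /
`band_virial_ge_of_slice` (p685912):

* §1 `integral_prod_smoothingKernel_weight_eq_pairing` — Fubini: the virial's double integral IS the pairing `⟨K_q∗Y, (τ−c)Y⟩ = ∫ (K_q∗Y)(τ)·conj Y(τ)·(τ−c)dτ`;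
* §2 `two_re_I_mul_pairing_modelSelf` — the identity part drops: `i·P_M + conj(i·P_M) = −(i·P_K + conj(i·P_K))` for `P_M = ⟨M_qY,(τ−c)Y⟩`,
  `P_K = ⟨K_q∗Y,(τ−c)Y⟩` (`(2/q)∫|Y|²(τ−c)` is real);
* §3 `model_mourre_inequality` — if `Ŷ` vanishes where `𝔖′(z√q) < σ₀` then `(σ₀/√q)·∫‖Y‖² ≤ (∫‖M_qY‖²)^{1/2}·(∫‖(τ−c)Y‖²)^{1/2}`
  (virial gain `(2σ₀/√q)‖Y‖² ≤ (1/(π√q))∫𝔖′|Ŷ|² = 2Re(i·P_M) ≤ 2|P_M|`, then Hölder).  Read contrapositively: a band-localised approximate kernel vector of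
  `M_q` (‖M_qY‖ ≤ η‖Y‖) must be spatially spread, `‖(τ−c)Y‖₂ ≥ (σ₀/(η√q))‖Y‖₂` — the quantitative form of "band packets cannot sit in the ball" that the
  design's B5 uses (there with `(τ−c)` bounded by `R/cg` on the ball).

Lane ns-filament-19175-p1 g15; `--supports stmt-NavierStokesRegularity-23612 --as helper`.
HONEST FRAMING: an inequality about an explicit model operator attached to a HYPOTHETICAL filament skeleton on the NEGATIVE side of a MODEL route;
nothing here bears on Navier–Stokes regularity or blow-up; 23610/23611/23612/23320 stay OPEN.
-/

noncomputable section

open MeasureTheory Real Complex Filter Set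
open scoped FourierTransform ComplexConjugate Topology
open Summit.NavierStokesRegularity.NavierStokesRegularity.Theorems.AnalyticStripLiaSymbol (liaSym)

namespace Summit.NavierStokesRegularity.NavierStokesRegularity.Theorems.MatchedKernel
set_option linter.dupNamespace false

/-! ## §1 The double integral of the virial is the pairing `⟨K_q∗Y, (τ−c)Y⟩` -/

/-- The smoothing kernel is bounded: `|K_q(s)| ≤ 2q^{-3/2}`. [folklore] -/
theorem abs_smoothingKernel_le_const {q : ℝ} (hq : 0 < q) (s : ℝ) :
    |(2 * q - s ^ 2) * ((s ^ 2 + q) ^ (5 / 2 : ℝ))⁻¹| ≤ 2 * (q ^ (3 / 2 : ℝ))⁻¹ := by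
  refine (abs_smoothingKernel_le hq s).trans ?_
  have hq32 : 0 < q ^ (3 / 2 : ℝ) := Real.rpow_pos_of_pos hq _
  have hle : q ^ (3 / 2 : ℝ) ≤ (s ^ 2 + q) ^ (3 / 2 : ℝ) :=
    Real.rpow_le_rpow hq.le (by nlinarith [sq_nonneg s]) (by norm_num)
  have := inv_anti₀ hq32 hle
  linarith

/-- Integrability of the virial integrand `K_q(τ−σ)Y(σ)conj Y(τ)(τ−c)` on `ℝ × ℝ` for `Y, (τ−c)Y ∈ L¹`. [folklore] -/
theorem integrable_smoothingKernel_weight {q : ℝ} (hq : 0 < q) {c : ℝ} {Y : ℝ → ℂ} (hY : Integrable Y)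
    (hwY : Integrable (fun τ : ℝ => ((τ - c : ℝ) : ℂ) * Y τ)) :
    Integrable (fun p : ℝ × ℝ => ((((2 * q - (p.1 - p.2) ^ 2) * (((p.1 - p.2) ^ 2 + q) ^ (5 / 2 : ℝ))⁻¹ : ℝ)) : ℂ)
      * (Y p.2 * conj (Y p.1)) * ((p.1 - c : ℝ) : ℂ)) (volume.prod volume) := by
  have hKm : AEStronglyMeasurable (fun p : ℝ × ℝ =>
      ((((2 * q - (p.1 - p.2) ^ 2) * (((p.1 - p.2) ^ 2 + q) ^ (5 / 2 : ℝ))⁻¹ : ℝ)) : ℂ)) (volume.prod volume) := by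
    refine Continuous.aestronglyMeasurable ?_
    exact Complex.continuous_ofReal.comp ((continuous_smoothingKernel hq).comp (continuous_fst.sub continuous_snd))
  have hbase : Integrable (fun p : ℝ × ℝ => Y p.2 * conj (((p.1 - c : ℝ) : ℂ) * Y p.1)) (volume.prod volume) :=
    integrable_prod_mul_conj hY hwY
  refine ((hbase.bdd_mul hKm (c := 2 * (q ^ (3 / 2 : ℝ))⁻¹)) (Eventually.of_forall fun p => ?_)).congr
    (Eventually.of_forall fun p => ?_)
  · rw [Complex.norm_real, Real.norm_eq_abs]
    exact abs_smoothingKernel_le_const hq _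
  · simp only [map_mul, Complex.conj_ofReal]
    ring

/-- **Fubini for the virial**: `∫_{ℝ×ℝ} K_q(τ−σ)Y(σ)conj Y(τ)(τ−c) = ∫ (K_q∗Y)(τ)·conj Y(τ)·(τ−c) dτ`, `(K_q∗Y)(τ) = ∫K_q(τ−σ)Y(σ)dσ`. [folklore] -/
theorem integral_prod_smoothingKernel_weight_eq_pairing {q : ℝ} (hq : 0 < q) {c : ℝ} {Y : ℝ → ℂ} (hY : Integrable Y)
    (hwY : Integrable (fun τ : ℝ => ((τ - c : ℝ) : ℂ) * Y τ)) :
    ∫ p : ℝ × ℝ, ((((2 * q - (p.1 - p.2) ^ 2) * (((p.1 - p.2) ^ 2 + q) ^ (5 / 2 : ℝ))⁻¹ : ℝ)) : ℂ)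
        * (Y p.2 * conj (Y p.1)) * ((p.1 - c : ℝ) : ℂ) ∂(volume.prod volume)
      = ∫ τ : ℝ, (∫ σ : ℝ, ((((2 * q - (τ - σ) ^ 2) * (((τ - σ) ^ 2 + q) ^ (5 / 2 : ℝ))⁻¹ : ℝ)) : ℂ) * Y σ)
          * conj (Y τ) * ((τ - c : ℝ) : ℂ) := by
  rw [integral_prod _ (integrable_smoothingKernel_weight hq hY hwY)]
  refine integral_congr_ae (Eventually.of_forall fun τ => ?_)
  simp only
  rw [← integral_mul_const, ← integral_mul_const]
  refine integral_congr_ae (Eventually.of_forall fun σ => ?_)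
  simp only
  ring

/-! ## §2 The identity part of `M_q` drops from the virial -/

/-- `∫ (2/q)·Y·conj Y·(τ−c)` is `i`-antisymmetric: `i·R + conj(i·R) = 0` for this (real) integral. [folklore] -/
theorem I_mul_integral_weight_normSq_add_conj (q c : ℝ) (Y : ℝ → ℂ) :
    I * (∫ τ : ℝ, (2 / q : ℂ) * Y τ * conj (Y τ) * ((τ - c : ℝ) : ℂ))
      + conj (I * ∫ τ : ℝ, (2 / q : ℂ) * Y τ * conj (Y τ) * ((τ - c : ℝ) : ℂ)) = 0 := by
  have hreal : ∫ τ : ℝ, (2 / q : ℂ) * Y τ * conj (Y τ) * ((τ - c : ℝ) : ℂ)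
      = ((∫ τ : ℝ, 2 / q * ‖Y τ‖ ^ 2 * (τ - c) : ℝ) : ℂ) := by
    rw [← integral_complex_ofReal]
    refine integral_congr_ae (Eventually.of_forall fun τ => ?_)
    simp only
    rw [show (2 / q : ℂ) * Y τ * conj (Y τ) * ((τ - c : ℝ) : ℂ) = (2 / q : ℂ) * (Y τ * conj (Y τ)) * ((τ - c : ℝ) : ℂ) by ring,
      Complex.mul_conj']
    push_cast
    ring
  rw [hreal]
  exact I_mul_real_add_conj _

/-- **The identity part drops.**  With `P_K = ∫(K_q∗Y)conj Y(τ−c)` and `P_M = ∫(M_qY)conj Y(τ−c)`, `M_qY = (2/q)Y − K_q∗Y`: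
`i·P_M + conj(i·P_M) = −(i·P_K + conj(i·P_K))`, provided both pairings are integrable. [folklore] -/
theorem two_re_I_mul_pairing_modelSelf {q c : ℝ} {Y KY : ℝ → ℂ}
    (h1 : Integrable (fun τ : ℝ => (2 / q : ℂ) * Y τ * conj (Y τ) * ((τ - c : ℝ) : ℂ)))
    (h2 : Integrable (fun τ : ℝ => KY τ * conj (Y τ) * ((τ - c : ℝ) : ℂ))) :
    I * (∫ τ : ℝ, ((2 / q : ℂ) * Y τ - KY τ) * conj (Y τ) * ((τ - c : ℝ) : ℂ))
      + conj (I * ∫ τ : ℝ, ((2 / q : ℂ) * Y τ - KY τ) * conj (Y τ) * ((τ - c : ℝ) : ℂ))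
      = -(I * (∫ τ : ℝ, KY τ * conj (Y τ) * ((τ - c : ℝ) : ℂ))
          + conj (I * ∫ τ : ℝ, KY τ * conj (Y τ) * ((τ - c : ℝ) : ℂ))) := by
  have hsplit : ∫ τ : ℝ, ((2 / q : ℂ) * Y τ - KY τ) * conj (Y τ) * ((τ - c : ℝ) : ℂ)
      = (∫ τ : ℝ, (2 / q : ℂ) * Y τ * conj (Y τ) * ((τ - c : ℝ) : ℂ))
        - ∫ τ : ℝ, KY τ * conj (Y τ) * ((τ - c : ℝ) : ℂ) := by
    rw [← integral_sub h1 h2]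
    refine integral_congr_ae (Eventually.of_forall fun τ => ?_)
    simp only
    ring
  have h0 := I_mul_integral_weight_normSq_add_conj q c Y
  rw [hsplit, mul_sub, map_sub]
  linear_combination h0

/-! ## §3 The model Mourre inequality -/

/-- Hölder/Cauchy–Schwarz for the pairing: `‖∫ A·conj Y·(τ−c)‖ ≤ (∫‖A‖²)^{1/2}·(∫‖(τ−c)Y‖²)^{1/2}`. [folklore] -/
theorem norm_pairing_le {c : ℝ} {A Y : ℝ → ℂ} (hA : MemLp A 2) (hwY : MemLp (fun τ : ℝ => ((τ - c : ℝ) : ℂ) * Y τ) 2) :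
    ‖∫ τ : ℝ, A τ * conj (Y τ) * ((τ - c : ℝ) : ℂ)‖
      ≤ (∫ τ : ℝ, ‖A τ‖ ^ 2) ^ (1 / 2 : ℝ) * (∫ τ : ℝ, ‖((τ - c : ℝ) : ℂ) * Y τ‖ ^ 2) ^ (1 / 2 : ℝ) := by
  refine (norm_integral_le_integral_norm _).trans ?_
  have hpt : ∀ τ : ℝ, ‖A τ * conj (Y τ) * ((τ - c : ℝ) : ℂ)‖ = ‖A τ‖ * ‖((τ - c : ℝ) : ℂ) * Y τ‖ := by
    intro τ
    rw [norm_mul, norm_mul, norm_mul, Complex.norm_conj]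
    ring
  simp_rw [hpt]
  have hA' : MemLp (fun τ : ℝ => ‖A τ‖) (ENNReal.ofReal 2) := by
    rw [show ENNReal.ofReal (2:ℝ) = 2 by simp]; exact hA.norm
  have hB' : MemLp (fun τ : ℝ => ‖((τ - c : ℝ) : ℂ) * Y τ‖) (ENNReal.ofReal 2) := by
    rw [show ENNReal.ofReal (2:ℝ) = 2 by simp]; exact hwY.norm
  have h := integral_mul_le_Lp_mul_Lq_of_nonneg Real.HolderConjugate.two_two
    (Eventually.of_forall fun τ => norm_nonneg (A τ))
    (Eventually.of_forall fun τ => norm_nonneg (((τ - c : ℝ) : ℂ) * Y τ)) hA' hB'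
  simp only [Real.rpow_two] at h
  exact h

/-- `L² × L²` pairings are integrable: `A·conj Y·(τ−c) ∈ L¹` for `A, (τ−c)Y ∈ L²`. [folklore] -/
theorem integrable_pairing {c : ℝ} {A Y : ℝ → ℂ} (hA : MemLp A 2) (hwY : MemLp (fun τ : ℝ => ((τ - c : ℝ) : ℂ) * Y τ) 2) :
    Integrable (fun τ : ℝ => A τ * conj (Y τ) * ((τ - c : ℝ) : ℂ)) := by
  have hconj : MemLp (fun τ : ℝ => conj (((τ - c : ℝ) : ℂ) * Y τ)) 2 :=
    MemLp.of_le hwY (Complex.continuous_conj.comp_aestronglyMeasurable hwY.1)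
      (Eventually.of_forall fun τ => by rw [Complex.norm_conj])
  have h := hA.integrable_mul hconj
  refine h.congr (Eventually.of_forall fun τ => ?_)
  simp only [Pi.mul_apply, map_mul, Complex.conj_ofReal]
  ring

/-- **THE MODEL MOURRE INEQUALITY.**  Let `q > 0`, `σ₀ c : ℝ`, and `Y : ℝ → ℂ` continuous with `Y ∈ L¹ ∩ L²`, `x·Y ∈ L¹`, `(τ−c)Y ∈ L²`, whose
model self image `M_qY = (2/q)Y − K_q∗Y` is in `L²`, and whose transform `Ŷ(z) = ∫Y(x)e^{izx}dx` vanishes wherever `𝔖′(z√q) < σ₀`.  Then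
`(σ₀/√q)·∫‖Y‖² ≤ (∫‖M_qY‖²)^{1/2} · (∫‖(τ−c)Y‖²)^{1/2}`. [folklore; the Mourre estimate of DESIGN-NOTE-28296 §4 in the constant-core model] -/
theorem model_mourre_inequality {q σ₀ : ℝ} (hq : 0 < q) {Y : ℝ → ℂ} (hYc : Continuous Y) (hY : Integrable Y) (hY2 : MemLp Y 2)
    (hxY : Integrable (fun x : ℝ => x • Y x)) (c : ℝ) (hwY2 : MemLp (fun τ : ℝ => ((τ - c : ℝ) : ℂ) * Y τ) 2)
    (hM2 : MemLp (fun τ : ℝ => (2 / q : ℂ) * Y τ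
      - ∫ σ : ℝ, ((((2 * q - (τ - σ) ^ 2) * (((τ - σ) ^ 2 + q) ^ (5 / 2 : ℝ))⁻¹ : ℝ)) : ℂ) * Y σ) 2)
    (hsupp : ∀ z : ℝ, deriv liaSym (z * √q) < σ₀ → ∫ x : ℝ, Y x * cexp (I * z * x) = 0) :
    σ₀ / √q * ∫ x : ℝ, ‖Y x‖ ^ 2
      ≤ (∫ τ : ℝ, ‖(2 / q : ℂ) * Y τ
            - ∫ σ : ℝ, ((((2 * q - (τ - σ) ^ 2) * (((τ - σ) ^ 2 + q) ^ (5 / 2 : ℝ))⁻¹ : ℝ)) : ℂ) * Y σ‖ ^ 2) ^ (1 / 2 : ℝ)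
        * (∫ τ : ℝ, ‖((τ - c : ℝ) : ℂ) * Y τ‖ ^ 2) ^ (1 / 2 : ℝ) := by
  -- `(τ−c)Y ∈ L¹` from `x•Y ∈ L¹`
  have hwY : Integrable (fun τ : ℝ => ((τ - c : ℝ) : ℂ) * Y τ) := by
    have h1 : Integrable (fun τ : ℝ => (τ : ℂ) * Y τ) :=
      hxY.congr (Eventually.of_forall fun x => by simp [Complex.real_smul])
    have h2 : Integrable (fun τ : ℝ => (c : ℂ) * Y τ) := hY.const_mul _
    refine (h1.sub h2).congr (Eventually.of_forall fun τ => ?_)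
    simp only [Pi.sub_apply]
    push_cast; ring
  -- STEP 1: band gain and virial identity (p685912), the latter in pairing form (§1)
  have hgain := band_virial_ge_of_slice hq hY hY2 hsupp
  have hvir := band_virial_identity hq hYc hY hY2 hxY c
  rw [Measure.volume_eq_prod, integral_prod_smoothingKernel_weight_eq_pairing hq hY hwY] at hvir
  -- abbreviate the convolution
  set KY : ℝ → ℂ := fun τ => ∫ σ : ℝ, ((((2 * q - (τ - σ) ^ 2) * (((τ - σ) ^ 2 + q) ^ (5 / 2 : ℝ))⁻¹ : ℝ)) : ℂ) * Y σ
    with hKYdef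
  -- STEP 2: the identity part drops (§2)
  have hKY2 : MemLp KY 2 := by
    have h := (hY2.const_mul (2 / q : ℂ)).sub hM2
    refine MemLp.ae_eq (Eventually.of_forall fun τ => ?_) h
    simp only [Pi.sub_apply]
    ring
  have h1 : Integrable (fun τ : ℝ => (2 / q : ℂ) * Y τ * conj (Y τ) * ((τ - c : ℝ) : ℂ)) :=
    integrable_pairing (hY2.const_mul _) hwY2
  have h2 : Integrable (fun τ : ℝ => KY τ * conj (Y τ) * ((τ - c : ℝ) : ℂ)) := integrable_pairing hKY2 hwY2
  have hdrop := two_re_I_mul_pairing_modelSelf (q := q) (c := c) h1 h2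
  have hsum : I * (∫ τ : ℝ, ((2 / q : ℂ) * Y τ - KY τ) * conj (Y τ) * ((τ - c : ℝ) : ℂ))
      + conj (I * ∫ τ : ℝ, ((2 / q : ℂ) * Y τ - KY τ) * conj (Y τ) * ((τ - c : ℝ) : ℂ))
      = ((((1 / (π * √q)) * ∫ z : ℝ, deriv liaSym (z * √q) * ‖∫ x : ℝ, Y x * cexp (I * z * x)‖ ^ 2) : ℝ) : ℂ) := by
    rw [hdrop, hvir, neg_neg]
  -- STEP 3: real parts, Cauchy–Schwarz
  set PM : ℂ := ∫ τ : ℝ, ((2 / q : ℂ) * Y τ - KY τ) * conj (Y τ) * ((τ - c : ℝ) : ℂ) with hPMdef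
  have hre : (1 / (π * √q)) * ∫ z : ℝ, deriv liaSym (z * √q) * ‖∫ x : ℝ, Y x * cexp (I * z * x)‖ ^ 2
      = 2 * (I * PM).re := by
    have h := hsum
    rw [Complex.add_conj] at h
    exact_mod_cast h.symm
  have hnorm : (I * PM).re ≤ ‖PM‖ := by
    refine (Complex.re_le_norm _).trans ?_
    rw [norm_mul, Complex.norm_I, one_mul]
  have hCS := norm_pairing_le (A := fun τ : ℝ => (2 / q : ℂ) * Y τ - KY τ) hM2 hwY2
  calc σ₀ / √q * ∫ x : ℝ, ‖Y x‖ ^ 2 = (1 / 2) * (2 * σ₀ / √q * ∫ x : ℝ, ‖Y x‖ ^ 2) := by ring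
    _ ≤ (1 / 2) * ((1 / (π * √q)) * ∫ z : ℝ, deriv liaSym (z * √q) * ‖∫ x : ℝ, Y x * cexp (I * z * x)‖ ^ 2) :=
        mul_le_mul_of_nonneg_left hgain (by norm_num)
    _ = (I * PM).re := by rw [hre]; ring
    _ ≤ ‖PM‖ := hnorm
    _ ≤ _ := hCS

end Summit.NavierStokesRegularity.NavierStokesRegularity.Theorems.MatchedKernel

end
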